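import Summits.KontsevichZagierPeriods.KontsevichZagierPeriods.Theses.StandardParts
import Literature.NumberTheory.Transcendental.KZTameMoveFamily
import Literature.NumberTheory.Transcendental.KZTameCert

/-!
# `SpTameNoBlowUp` (stmt-KontsevichZagierPeriods-18035, route StandardParts) — BIRTH SKELETON

Piece X₂ of the crux-strategist's BC2-redirect split of the deciding crux `SpArcLifting` (stmt-3155):
**NO BLOW-UP** — if two `N`-tame raw `ℚ`-semialgebraic families `S` (dim `k`), `S'` (dim `k'`) form an
ARC OF IDENTITIES (at every rational `q ∈ (0,1)` all integral representations realising the two fibres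
are `KZ.Equivalent`), then on some `(0, δ)`, `δ ∈ ℚ_{>0}`, the difference of fibre generators
`t ↦ S.gen t − S'.gen t` is ONE tame uniform chain (`KZ.TameUniformChainOn N' (Ioo 0 δ)`).

The crux (FIXED, never restated here):
`Summit.KontsevichZagierPeriods.KontsevichZagierPeriods.Theses.StandardParts.SpTameNoBlowUp`.

## The line: tame conservativity → bounded complexity near `0⁺` → uniformisation by definable choice

The pointwise identities `S_q ∼ S'_q` are a priori witnessed by chains of UNBOUNDED description
complexity through arbitrary (non-tame) `ℚ`-semialgebraic intermediates, depending on the arithmetic of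
`q`. The line isolates the three things that must hold for ONE template to exist near `0⁺`, using the
complexity-bounded tame move calculus `KZ.tameMoves N` of `KZTameCert.lean` (raw real pairs of dimension
`≤ N`, domains in `[−N, N]ᵏ`, `|f| ≤ N`, description complexity `≤ N` in the tree's coded ordered-ring
language with `≤ N` REAL parameters — so that a rational parameter `q` costs nothing):

* `stub_tameConservativity` (L): TAME CONSERVATIVITY — at each rational `q ∈ (0,1)` the identity between
  the two TAME fibre pairs has a TAME certificate of SOME size `N_q`: `S.gen q − S'.gen q = Σ_{i<N_q} mᵢ`,
  `mᵢ ∈ ±tameMoves N_q ∪ {0}`. (Identities between bounded data have bounded proofs: compactify and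
  bound every intermediate of the given `ℚ`-chain by Viu-Sos-type reductions INSIDE the chain; route
  InequalityCost flags that no tame conservativity theorem is in print — KILL CRITERION (ii) there.)
* `stub_boundedComplexityNearZero` (XL, the hardest, the genuine no-blow-up): if tame certificates exist
  at every rational `q ∈ (0,1)`, then their size is BOUNDED on the rationals of some `(0, δ)`:
  `∃ N' δ, ∀ q ∈ ℚ ∩ (0,δ), ∃ m : Fin N' → _, …`. This is where special fibres could defeat the line
  (extra identities at parameters of large height); its positive content is the definability of the
  proof relation in families (cf. Ayoub's relative version of the conjecture, a THEOREM at the motivic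
  level, and card definable-move-relation-tarski-transfer: `E_N` is semialgebraic).
* `stub_uniformFromPointwise` (L, provable in principle now): bounded-size certificates at all rationals
  of `(0, δ)` ⇒ ONE tame uniform chain on some `(0, δ')`: for fixed `N'` the level set
  `L = {t ∈ (0,δ) | a size-N' certificate exists at t}` is a finite union over the finitely many
  discrete templates (dimensions, formula codes `≤ N'`, move kinds, signs, coincidence pattern) of
  projections of `∅`-definable sets — every side condition of `tameMoves` is first-order in the real
  parameters `θ` — hence semialgebraic over `ℚ` (`tarski_seidenberg_real_holds`); `L ⊇ ℚ ∩ (0,δ)` is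
  dense, so `L` is cofinite in `(0,δ)` and ONE template covers some `(0,δ')`; DEFINABLE CHOICE
  (van den Dries Ch. 6 (1.2); InequalityCost.DefinableChoice, item 8993) picks `θ(t)` `∅`-definably,
  i.e. `ℚ`-semialgebraic TOTAL data, which is a `KZ.TameUniformChainOn N'' (Ioo 0 δ')` for the raw
  move-family structures of `KZTameMoveFamily.lean` (tameness bounds carried along).

Assembly `SpTameNoBlowUp_of` = the three stubs chained (kernel-checked; `sorry` only inside `stub_*`).
The types `KZ.RawGroup` (generators `S.gen q`) and `KZ.RawFormal` (certificates) are the same free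
abelian group on raw pairs `Σ k, Set (Fin k → ℝ) × ((Fin k → ℝ) → ℝ)`.

Disproof used: none relevant (no `Disproof.lean` / Negative lemma for 18035 or 3155; `ledger negatives`:
1 entry, KinematicPlaneConvex, unrelated). NOT summit-implied (the summit says nothing about uniformity):
a refutation of `stub_boundedComplexityNearZero` by a tame arc of identities with provably unbounded
certificate complexity would kill the o-minimal standard-part mechanism in general and is informative for
route Neg. Dead lines avoided: typed arcs `ℝ → KZ.IntegralRep n` (eventually constant) are not used.

References: Kontsevich–Zagier 2001 §1.2 [KontsevichZagier2001]; van den Dries 1998 Ch. 6 (1.2), Ch. 9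
[Dries1998]; Basu–Pollack–Roy 2006 §2.3, Thm 2.77 [BasuPollackRoy2006]; Tarski 1951 [Tarski1951];
Ayoub 2015 / relative KZ revisited Thm 1.11 [Ayoub2015, AyoubRelKZRevisited]; Viu-Sos 2021 §4 [ViuSos2021].
-/

noncomputable section

open Set MeasureTheory Filter
open scoped Topology BigOperators
open Literature.NumberTheory.Transcendental
open Literature.ModelTheory.ExponentialFields (IsSemialgebraic)
open Summit.KontsevichZagierPeriods.KontsevichZagierPeriods.Theses.StandardParts (SpTameNoBlowUp)

namespace Summit.KontsevichZagierPeriods.KontsevichZagierPeriods.Cruxes.SpTameNoBlowUp.Birth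

/-! ## Stubs of the line -/

/-- STUB `stub_tameConservativity` (L). **Tame conservativity, pointwise.** If two `N`-tame raw families
form an arc of identities, then at every rational `q ∈ (0,1)` the difference of fibre generators
`S.gen q − S'.gen q` is a signed sum of finitely many COMPLEXITY-BOUNDED TAME move instances
(`KZ.tameMoves N_q`, real parameters allowed) of SOME size `N_q` depending on `q`: identities between
tame pairs have tame certificates. Why plausibly true: the given `ℚ`-chain at `q` can be compactified
and its intermediates bounded inside the rules (Viu-Sos' reductions are now theorems of the tree:
`KZ.semiCanonicalReduction_holds`), and `ℚ`-semialgebraic data of a finite chain have some finite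
description complexity. Why it might fail: an identity between bounded data needing an unbounded
intermediate ESSENTIALLY (no tame conservativity theorem in print).
[cite: KontsevichZagier2001, §1.2] [cite: ViuSos2021, §4] [cite: BasuPollackRoy2006, §2.3] -/
theorem stub_tameConservativity :
    ∀ (N : ℕ) ⦃k k' : ℕ⦄ (S : KZ.RawFamily k) (S' : KZ.RawFamily k'), S.IsTame N → S'.IsTame N →
      (∀ q : ℚ, (q : ℝ) ∈ Set.Ioo (0:ℝ) 1 → ∀ (ρ : KZ.IntegralRep k) (ρ' : KZ.IntegralRep k'),
        ρ.domain = S.fibre q → Set.EqOn ρ.integrand (S.fibreFun q) (S.fibre q) →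
        ρ'.domain = S'.fibre q → Set.EqOn ρ'.integrand (S'.fibreFun q) (S'.fibre q) →
        KZ.Equivalent ρ ρ') →
      ∀ q : ℚ, (q : ℝ) ∈ Set.Ioo (0:ℝ) 1 → ∃ (Nq : ℕ) (m : Fin Nq → KZ.RawFormal),
        (∀ i, m i ∈ KZ.tameMoves Nq ∨ -m i ∈ KZ.tameMoves Nq ∨ m i = 0) ∧
        S.gen q - S'.gen q = ∑ i, m i := by
  sorry

/-- STUB `stub_boundedComplexityNearZero` (XL; the hardest — the genuine NO-BLOW-UP). **Pointwise tame
certificates at every rational parameter have BOUNDED size near `0⁺`.** If at every rational `q ∈ (0,1)`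
the difference `S.gen q − S'.gen q` of the fibre generators of two `N`-tame raw families has a tame
certificate of some size `N_q`, then there are `N'` and `δ ∈ ℚ_{>0}` such that at every rational
`q ∈ (0,δ)` a certificate of size `≤ N'` exists. Why plausibly true: the identity holds along a
`ℚ`-semialgebraic family, and generic identities of families come uniformly from geometry (Ayoub's
relative version of the conjecture is a theorem motivically; Hardt triviality bounds the combinatorics of
the fibres). Why it might fail: special fibres of large height may carry identities of unbounded
complexity (`E_N = [1/N, 1)` is consistent with tameness); a counterexample kills the standard-part
mechanism in general. [cite: AyoubRelKZRevisited, Thm 1.11] [cite: Ayoub2015, Thm 1.2]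
[cite: Dries1998, Ch. 9] [cite: KontsevichZagier2001, §1.2] -/
theorem stub_boundedComplexityNearZero :
    ∀ (N : ℕ) ⦃k k' : ℕ⦄ (S : KZ.RawFamily k) (S' : KZ.RawFamily k'), S.IsTame N → S'.IsTame N →
      (∀ q : ℚ, (q : ℝ) ∈ Set.Ioo (0:ℝ) 1 → ∃ (Nq : ℕ) (m : Fin Nq → KZ.RawFormal),
        (∀ i, m i ∈ KZ.tameMoves Nq ∨ -m i ∈ KZ.tameMoves Nq ∨ m i = 0) ∧
        S.gen q - S'.gen q = ∑ i, m i) →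
      ∃ (N' : ℕ) (δ : ℚ), 0 < δ ∧ ∀ q : ℚ, (q : ℝ) ∈ Set.Ioo (0:ℝ) δ →
        ∃ m : Fin N' → KZ.RawFormal,
          (∀ i, m i ∈ KZ.tameMoves N' ∨ -m i ∈ KZ.tameMoves N' ∨ m i = 0) ∧
          S.gen q - S'.gen q = ∑ i, m i := by
  sorry

/-- STUB `stub_uniformFromPointwise` (L; provable in principle now). **Uniformisation by first-order
levels and definable choice.** If at every rational `q` of some `(0,δ)` the difference of fibre
generators of two `N`-tame raw families has a tame certificate of size `≤ N'` (bounded number of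
complexity-bounded tame moves with real parameters), then on some `(0,δ')` it is ONE tame uniform chain
of raw `ℚ`-semialgebraic move families (`KZ.TameUniformChainOn N'' (Ioo 0 δ')`): the level set of each
of the finitely many discrete templates is a projection of an `∅`-definable set, hence `ℚ`-semialgebraic
(`tarski_seidenberg_real_holds`); their union contains `ℚ ∩ (0,δ)`, so it is cofinite in `(0,δ)` and one
template covers some `(0,δ')`; definable choice (van den Dries Ch. 6 (1.2); InequalityCost.DefinableChoice,
item 8993) selects the real parameters `∅`-definably in `t`, giving `ℚ`-semialgebraic TOTAL data, i.e.
raw move-family structures over `(0,δ')`, with tameness bounds carried along. Why it might fail: only by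
a bookkeeping mismatch between `KZ.tameMoves` (indicator-normalised real pairs) and the fields of the
`KZ.Raw*FamilyOn` structures — both copy the side conditions of `KZCalculus`.
[cite: Dries1998, Ch. 6 (1.2)] [cite: Tarski1951, Thm 1] [cite: BasuPollackRoy2006, Thm 2.77]
[cite: KontsevichZagier2001, §1.2] -/
theorem stub_uniformFromPointwise :
    ∀ (N : ℕ) ⦃k k' : ℕ⦄ (S : KZ.RawFamily k) (S' : KZ.RawFamily k'), S.IsTame N → S'.IsTame N →
      (∃ (N' : ℕ) (δ : ℚ), 0 < δ ∧ ∀ q : ℚ, (q : ℝ) ∈ Set.Ioo (0:ℝ) δ →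
        ∃ m : Fin N' → KZ.RawFormal,
          (∀ i, m i ∈ KZ.tameMoves N' ∨ -m i ∈ KZ.tameMoves N' ∨ m i = 0) ∧
          S.gen q - S'.gen q = ∑ i, m i) →
      ∃ (N'' : ℕ) (δ' : ℚ), 0 < δ' ∧
        KZ.TameUniformChainOn N'' (Set.Ioo (0:ℝ) δ') (fun t => S.gen t - S'.gen t) := by
  sorry

/-! ## Assembly (kernel-checked; `sorry` only through the three declared stubs): concludes the crux BY NAME -/

/-- **ASSEMBLY `SpTameNoBlowUp_of`.** Tame conservativity gives pointwise tame certificates at every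
rational parameter, no-blow-up bounds their size near `0⁺`, and first-order levels + definable choice
make them one tame uniform chain: the crux `StandardParts.SpTameNoBlowUp` by name.
[cite: KontsevichZagier2001, §1.2] [cite: Dries1998, Ch. 6 (1.2)] -/
theorem SpTameNoBlowUp_of : SpTameNoBlowUp := by
  intro N k k' S S' hS hS' hid
  exact stub_uniformFromPointwise N S S' hS hS'
    (stub_boundedComplexityNearZero N S S' hS hS' (stub_tameConservativity N S S' hS hS' hid))

end Summit.KontsevichZagierPeriods.KontsevichZagierPeriods.Cruxes.SpTameNoBlowUp.Birth
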